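import Literature.MathematicalPhysics.QuantumFieldTheory.Balaban1983to89.Node00.BackgroundActionOfRecord
import Literature.MathematicalPhysics.QuantumFieldTheory.Balaban1983to89.Node00.BackgroundActionT
import Literature.MathematicalPhysics.QuantumFieldTheory.Balaban1983to89.Node00.LocalizedTermsShape

/-!
# `Balaban1983to89.Node00.LocalizedTermsAtRecord` — T. Bałaban, *Renormalization group approach to lattice gauge field
theories. I*, Commun. Math. Phys. **109** (1987) 249–301 [Balaban1987RG1], (0.24) p. 257 AT THE RECORD'S OBJECTS: the
adapter from the generic shape `Node00.LocalizedFamily` (module `Node00.LocalizedTermsShape`) to the reading of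
`𝐄^{(j+1)}(U_k(V))` in the format predicate `Node00.ReprAOfRecord` of ₈a `Node00.BackgroundActionOfRecord`

statement-level skeleton of published theorems with citation tags; proofs where landed; nothing here is a claim about
the Yang–Mills mass gap

CITATION HEADER (verbatim, p. 257 [PDF 9]): *"𝐄^{(j)}(U) = Σ_{X∈𝐃_j} 𝐄^{(j)}(X, U)"* (0.24); p. 256 [PDF 8]: (0.23).

WHY THIS FILE (cell `pub-ymgap`, D-0062 Track A, NODE 00 ₈; definer `node00-def-B`'s second hand block, seat
`pub-ymgap-dag-n10-b`, [NODE00-DEF-B-G0-HAND-WORD-2] item (3)): the ONE adapter naming (0.24) at the record —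
`repr024AtRecord`: for `V` in the domain and `j < k`, the merged term `𝓝_{j+1}` at `Ū^{j+1}(U_k(V))` (EXACTLY the reading
of `𝐄^{(j+1)}(U_k(V))` in the second conjunct of `ReprAOfRecord`) equals `Σ_{X∈𝐃_{j+1}} 𝐄^{(j+1)}(X, U_k(V))` for a localized
family of functions of the fine background field — a PREDICATE (Theorem 1 ∕ 3 of [I] is what would prove it; asserted
nowhere), plus the rewrite `reprAOfRecord_snd_expand` combining it with `ReprAOfRecord`.  This is the only module of the
block importing ₈a.
v1.1 (append-only, on the definer's word [NODE00-DEF-B-G0-SEAT-CLOSE]): the TRANSPORT-GENERIC twin `repr024AtRecordT (T)`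
over `Node00.BackgroundActionT.mergedTermT` with the `rfl` bridge `repr024AtRecord_eq_T` at `T := TOfRecord F N`, and
`reprAOfRecordT_snd_expand`.
HONEST SCOPE.  A format predicate over the record's objects by name; nothing of Bałaban's asserted; no estimate; counts
unmoved; not continuum ∕ ℝ⁴ ∕ OS ∕ mass-gap ∕ Clay.  No `sorry`, no instance, no notation.
-/

noncomputable section

namespace Literature.MathematicalPhysics.QuantumFieldTheory.Balaban1983to89.Node00

open Literature.MathematicalPhysics.QuantumFieldTheory.Balaban1983to89

variable (F : T4Continuum.T4Family) (N : ℕ) [NeZero N]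

/-- **(0.24) AT THE RECORD** — p. 257 [PDF 9] *"𝐄^{(j)}(U) = Σ_{X∈𝐃_j} 𝐄^{(j)}(X, U)"* for the record's reading of
`𝐄^{(j+1)}(U_k(V))` (the merged term `𝓝_{j+1}` of ₈a at `Ū^{j+1}(U_k(V))`, as in `ReprAOfRecord`): for `V ∈ dom` and `j < k`,
`mergedTerm … j (Ū^{j+1}(U_k(V))) = Σ_{X∈𝐃_{j+1}} fam.term (j+1) X (U_k(V))`.  A predicate, asserted nowhere. [cite: Balaban1987RG1, (0.24) p.257] -/
def repr024AtRecord (χ : (K : ℕ) → (ℕ → ℝ) → (k : ℕ) → Density (F.P K) k (SU N)) (ε : ℝ) (p : B12.RunParams) (k : ℕ)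
    (hist : Fin (k + 1) → ℝ) (dom : Set (GaugeField (F.P p.K) k (SU N))) (fam : LocalizedFamily (F.P p.K) (SU N)) : Prop :=
  ∀ V ∈ dom, ∀ j ∈ Finset.range k,
    mergedTerm F N χ ε p.K (T4FlagMemory.extd hist) j (Averaging.iter (avOfRecord F N p.K) (j + 1) (Uk F N p.K k ε V)) =
      ∑ X : (fam.sys (j + 1)).Dom, fam.term (j + 1) X (Uk F N p.K k ε V)

/-- **`ReprA` + (0.24) at the record ⇒ the expanded (0.23)–(0.24)**: on the domain,
`E V = Σ_{j<k} (−β_j · W V + Σ_{X∈𝐃_{j+1}} 𝐄^{(j+1)}(X, U_k(V)))` (rewrite only). [cite: Balaban1987RG1, (0.23)–(0.24) pp.256–257] -/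
theorem reprAOfRecord_snd_expand {χ : (K : ℕ) → (ℕ → ℝ) → (k : ℕ) → Density (F.P K) k (SU N)} {ε : ℝ} {β : FlowStep.HBeta}
    {p : B12.RunParams} {k : ℕ} {hist : Fin (k + 1) → ℝ} {dom : Set (GaugeField (F.P p.K) k (SU N))}
    {A W E : GaugeField (F.P p.K) k (SU N) → ℝ} {fam : LocalizedFamily (F.P p.K) (SU N)}
    (hA : ReprAOfRecord F N χ ε β p k hist dom A W E) (h24 : repr024AtRecord F N χ ε p k hist dom fam) :
    ∀ V ∈ dom, E V = ∑ j ∈ Finset.range k,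
      (-(β j (FlowStep.prefixOf (T4FlagMemory.extd hist) j)) * W V + ∑ X : (fam.sys (j + 1)).Dom, fam.term (j + 1) X (Uk F N p.K k ε V)) := by
  intro V hV
  rw [hA.2 V hV]
  exact Finset.sum_congr rfl fun j hj => by rw [h24 V hV j hj]

/-! ## v1.1 — the transport-generic twin (over `Node00.BackgroundActionT`) -/

/-- **(0.24) AT THE RECORD, GENERIC IN THE BLOCK TRANSPORT `T`** — the same predicate with the merged term
`mergedTermT F N T` of `Node00.BackgroundActionT` (so that it matches the second conjunct of `ReprAOfRecordT F N T`); at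
`T := TOfRecord F N` it is `repr024AtRecord` by `rfl` (`repr024AtRecord_eq_T`).  A predicate, asserted nowhere. [cite: Balaban1987RG1, (0.24) p.257] -/
def repr024AtRecordT (T : Transport F N) (χ : (K : ℕ) → (ℕ → ℝ) → (k : ℕ) → Density (F.P K) k (SU N)) (ε : ℝ)
    (p : B12.RunParams) (k : ℕ) (hist : Fin (k + 1) → ℝ) (dom : Set (GaugeField (F.P p.K) k (SU N)))
    (fam : LocalizedFamily (F.P p.K) (SU N)) : Prop :=
  ∀ V ∈ dom, ∀ j ∈ Finset.range k,
    mergedTermT F N T χ ε p.K (T4FlagMemory.extd hist) j (Averaging.iter (avOfRecord F N p.K) (j + 1) (Uk F N p.K k ε V)) =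
      ∑ X : (fam.sys (j + 1)).Dom, fam.term (j + 1) X (Uk F N p.K k ε V)

/-- Bridge: at the transport of record the generic predicate is `repr024AtRecord` (definitional). [cite: Balaban1987RG1, (0.24) p.257 (bookkeeping)] -/
theorem repr024AtRecord_eq_T (χ : (K : ℕ) → (ℕ → ℝ) → (k : ℕ) → Density (F.P K) k (SU N)) (ε : ℝ) (p : B12.RunParams)
    (k : ℕ) (hist : Fin (k + 1) → ℝ) (dom : Set (GaugeField (F.P p.K) k (SU N))) (fam : LocalizedFamily (F.P p.K) (SU N)) :
    repr024AtRecord F N χ ε p k hist dom fam = repr024AtRecordT F N (TOfRecord F N) χ ε p k hist dom fam := rfl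

/-- **`ReprAT` + (0.24) at the record, generic in `T` ⇒ the expanded (0.23)–(0.24)** (rewrite only). [cite: Balaban1987RG1, (0.23)–(0.24) pp.256–257] -/
theorem reprAOfRecordT_snd_expand {T : Transport F N} {χ : (K : ℕ) → (ℕ → ℝ) → (k : ℕ) → Density (F.P K) k (SU N)} {ε : ℝ}
    {β : FlowStep.HBeta} {p : B12.RunParams} {k : ℕ} {hist : Fin (k + 1) → ℝ} {dom : Set (GaugeField (F.P p.K) k (SU N))}
    {A W E : GaugeField (F.P p.K) k (SU N) → ℝ} {fam : LocalizedFamily (F.P p.K) (SU N)}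
    (hA : ReprAOfRecordT F N T χ ε β p k hist dom A W E) (h24 : repr024AtRecordT F N T χ ε p k hist dom fam) :
    ∀ V ∈ dom, E V = ∑ j ∈ Finset.range k,
      (-(β j (FlowStep.prefixOf (T4FlagMemory.extd hist) j)) * W V +
        ∑ X : (fam.sys (j + 1)).Dom, fam.term (j + 1) X (Uk F N p.K k ε V)) := by
  intro V hV
  rw [hA.2 V hV]
  exact Finset.sum_congr rfl fun j hj => by rw [h24 V hV j hj]

end Literature.MathematicalPhysics.QuantumFieldTheory.Balaban1983to89.Node00

end
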